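import Literature.Geometry.Kaehler.HolomorphicChainConvergentSubsequence
import Literature.Geometry.Kaehler.HolomorphicChainCurrentInjective
import Literature.Geometry.Kaehler.KaehlerFormPower
import HarnessLib

/-!
# Limits of positive holomorphic chains are positive

Layer `Literature/Geometry/Kaehler`; lane `lit-hodgefound`, programme «CHAIN COMPACTNESS», file F9:
the positivity clause of [Chirka1989, §16.1 Prop. 1]: "If, moreover, `T_j` are positive chains,
then the limit chain `T` is also positive" ("can be derived from Theorem 15.3 [Wirtinger], just as
in p.15.5"). A holomorphic chain is *positive* when all its multiplicities are `≥ 0`; we test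
chains against the forms `χ · K_p` (`K_p = ω^p/p!` the divided power of the Kähler form,
`kaehlerPow`, `χ ≥ 0` a test function):

* `HolomorphicChain.toCurrent_smul_kaehlerPow_nonneg` — a positive chain is a positive current on
  these forms: `[T](χ K_p) = ∫_{reg|T|} θ_T χ ≥ 0` (Wirtinger's equality `K_p(ξ_T) = 1`,
  `kaehlerPow_complexFrame`);
* `HolomorphicChain.mult_nonneg_of_toCurrent_smul_kaehlerPow_nonneg` — conversely, if
  `[T](χ K_p) ≥ 0` for all `χ ≥ 0` then `T` is positive: near a generic regular point `y` of a
  component `Z` (off the other components, which meet `Z` in a null set,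
  `euclideanHausdorffMeasure_image_inter_components_eq_zero`, while `Z` has positive measure near
  each of its points, `HasPureDim.euclideanHausdorffMeasure_image_inter_ball_pos`) the density is the
  multiplicity `k_Z`, so `0 ≤ [T](χ K_p) = k_Z ∫_{reg|T|} χ` with `∫ χ > 0`;
* `HolomorphicChain.mult_nonneg_of_tendsto` — weak limits of positive chains are positive;
* `HolomorphicChain.exists_subseq_tendsto_toCurrent_of_mult_nonneg` — Prop. 1 (2) for positive
  chains: a convergent subsequence with a POSITIVE limit chain.

(The remaining clause "`|T_j| → |T|` in the sense of §15.5" for positive chains is not treated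
here.) Theorems only; no new definitions, no named facts.

## References

* [Chirka1989] E. M. Chirka, *Complex Analytic Sets*, Kluwer 1989, §13.2 (Wirtinger), §16.1
  Prop. 1, pp. 206–207.
-/

noncomputable section

open scoped Manifold Topology ENNReal NNReal Distributions
open Set Filter MeasureTheory Metric Function TopologicalSpace

namespace Literature.Geometry.Kaehler

open Literature.Geometry.GeometricMeasureTheory

-- Nested operator-norm instances on (duals of) `V [⋀^Fin n]→L[ℝ] ℝ`.
set_option maxSynthPendingDepth 2

universe u

variable {V : Type u} [NormedAddCommGroup V] [InnerProductSpace ℂ V] [FiniteDimensional ℂ V]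
  [MeasurableSpace V] [BorelSpace V] {Ω : Opens V} {q : ℕ}

namespace HolomorphicChain

/-! ### The density of a positive chain -/

omit [FiniteDimensional ℂ V] [MeasurableSpace V] [BorelSpace V] in
/-- The density `Σ_{A_j ∋ x} k_j` of a chain with non-negative multiplicities is non-negative.
[cite: Chirka1989, §16.1, p. 206] -/
theorem multAt_nonneg {p : ℕ} (T : HolomorphicChain 𝓘(ℂ, V) Ω p) (h : ∀ Z, 0 ≤ T.mult Z) (x : Ω) :
    0 ≤ T.multAt x :=
  finsum_nonneg fun Z => Set.indicator_nonneg (fun _ _ => h Z) x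

omit [FiniteDimensional ℂ V] [MeasurableSpace V] [BorelSpace V] in
/-- The density `θ_T` (on `V`) of a chain with non-negative multiplicities is non-negative.
[cite: Chirka1989, §16.1, p. 206] -/
theorem density_nonneg {p : ℕ} (T : HolomorphicChain 𝓘(ℂ, V) Ω p) (h : ∀ Z, 0 ≤ T.mult Z) (x : V) :
    0 ≤ T.density x := by
  by_cases hx : x ∈ (Ω : Set V)
  · rw [show x = ((⟨x, hx⟩ : Ω) : V) from rfl, density_apply_coe]
    exact T.multAt_nonneg h _
  · rw [density_apply_of_notMem _ hx]

/-- **Wirtinger's equality on the carrier**: `K_p(ξ_T(x)) = 1` at every point of `reg|T|`.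
[cite: Chirka1989, §13.2] -/
theorem kaehlerPow_orientationFrame_of_mem_carrier {p : ℕ} (T : HolomorphicChain 𝓘(ℂ, V) Ω p)
    {x : V} (hx : x ∈ T.carrier) : kaehlerPow p (T.orientationFrame x) = 1 := by
  obtain ⟨u, hu, -, hξ⟩ := T.exists_orientationFrame_eq_complexFrame_span hx
  rw [hξ]
  exact kaehlerPow_complexFrame p u hu

/-- **`[T](χ K_p) = ∫_{reg|T|} θ_T χ d𝓗^{2p}`** for every test function `χ`.
[cite: Chirka1989, §13.3 Cor., §16.1] -/
theorem toCurrent_smul_kaehlerPow_apply (T : HolomorphicChain 𝓘(ℂ, V) Ω (q + 1)) (χ : 𝓓(Ω, ℝ)) :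
    T.toCurrent (smulCovectorCLM (kaehlerPow (q + 1)) χ) =
      ∫ x in T.carrier, (T.density x : ℝ) * χ x ∂(μHE[2 * (q + 1)] : Measure V) := by
  letI : InnerProductSpace ℝ V := InnerProductSpace.complexToReal
  have hT := Harvey1977_isRectifiableData_toCurrent_holds V Ω (q + 1) T
  rw [toCurrent_def, currentOfIntegration_apply hT.2.2.2.1]
  refine setIntegral_congr_fun T.measurableSet_carrier fun x hx => ?_
  rw [smulCovectorCLM_apply, ContinuousAlternatingMap.smul_apply,
    T.kaehlerPow_orientationFrame_of_mem_carrier hx, smul_eq_mul, mul_one]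

/-- **A positive chain is a positive current on the forms `χ K_p`, `χ ≥ 0`.**
[cite: Chirka1989, §16.1 Prop. 1, p. 207] -/
theorem toCurrent_smul_kaehlerPow_nonneg (T : HolomorphicChain 𝓘(ℂ, V) Ω (q + 1))
    (h : ∀ Z, 0 ≤ T.mult Z) (χ : 𝓓(Ω, ℝ)) (hχ : ∀ x, 0 ≤ χ x) :
    0 ≤ T.toCurrent (smulCovectorCLM (kaehlerPow (q + 1)) χ) := by
  rw [T.toCurrent_smul_kaehlerPow_apply χ]
  exact setIntegral_nonneg T.measurableSet_carrier fun x _ =>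
    mul_nonneg (by exact_mod_cast T.density_nonneg h x) (hχ x)

/-! ### Positivity of the multiplicities from positivity of the current -/

/-- **A chain whose current is non-negative on the forms `χ K_p` (`χ ≥ 0`) is positive.** Near a
regular point `y` of a component `Z` lying on no other component, `[T](χ K_p) = k_Z ∫_{reg|T|} χ`
for `χ` supported near `y`, and `∫_{reg|T|} χ > 0` for a bump `χ` at `y`.
[cite: Chirka1989, §16.1 Prop. 1, p. 207] -/
theorem mult_nonneg_of_toCurrent_smul_kaehlerPow_nonneg (T : HolomorphicChain 𝓘(ℂ, V) Ω (q + 1))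
    (hS : ∀ χ : 𝓓(Ω, ℝ), (∀ x, 0 ≤ χ x) → 0 ≤ T.toCurrent (smulCovectorCLM (kaehlerPow (q + 1)) χ))
    (Z : Set Ω) : 0 ≤ T.mult Z := by
  classical
  letI : InnerProductSpace ℝ V := InnerProductSpace.complexToReal
  haveI : FiniteDimensional ℝ V := FiniteDimensional.complexToReal V
  haveI : LocallyCompactSpace Ω := Ω.isOpen.locallyCompactSpace
  by_cases hZ : T.mult Z = 0
  · rw [hZ]
  set μ : Measure V := μHE[2 * (q + 1)] with hμ
  have hirr := T.isIrreducibleAnalyticSet_of_mult_ne_zero hZ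
  have hdim := T.hasPureDim_of_mult_ne_zero hZ
  obtain ⟨a, haZ⟩ := hirr.2.1
  -- a closed ball around `a` in `Ω` and the finitely many components meeting it
  obtain ⟨r₀, hr₀, hB⟩ : ∃ r₀ : ℝ, 0 < r₀ ∧ closedBall (a : V) r₀ ⊆ (Ω : Set V) := by
    obtain ⟨R, hR, hRΩ⟩ := Metric.isOpen_iff.1 Ω.isOpen (a : V) a.2
    exact ⟨R / 2, half_pos hR, (closedBall_subset_ball (half_lt_self hR)).trans hRΩ⟩
  have hKc : IsCompact (((↑) : Ω → V) ⁻¹' closedBall (a : V) r₀) := by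
    refine Topology.IsEmbedding.subtypeVal.isCompact_iff.2 ?_
    rw [image_preimage_eq_inter_range, Subtype.range_coe, inter_eq_left.2 hB]
    exact isCompact_closedBall _ _
  have hfin := T.finite_inter_compact hKc
  set F : Finset (Set Ω) := hfin.toFinset with hF
  have hFmem : ∀ Z' : Set Ω, T.mult Z' ≠ 0 → ∀ w : Ω, w ∈ Z' → (w : V) ∈ closedBall (a : V) r₀ →
      Z' ∈ F := fun Z' hZ' w hw hwB => by
    rw [hF, Set.Finite.mem_toFinset]
    exact ⟨hZ', w, hwB, hw⟩
  -- the other components, and the open set `U` off them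
  set F' : Finset (Set Ω) := F.filter (fun Z' => Z' ≠ Z) with hF'
  have hF'mem : ∀ Z', Z' ∈ F' ↔ Z' ∈ F ∧ Z' ≠ Z := fun Z' => Finset.mem_filter
  set U : Set Ω := (((↑) : Ω → V) ⁻¹' ball (a : V) r₀) \ ⋃ Z' ∈ F', Z' with hU
  have hUo : IsOpen U := by
    refine (isOpen_ball.preimage continuous_subtype_val).sdiff ?_
    refine isClosed_biUnion_finset fun Z' hZ' => ?_
    have hZ'F : Z' ∈ F := ((hF'mem Z').1 hZ').1
    rw [hF, Set.Finite.mem_toFinset] at hZ'F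
    exact (T.isIrreducibleAnalyticSet_of_mult_ne_zero hZ'F.1).1.isClosed
  -- components through a point of `U` coincide with `Z`
  have honly : ∀ w ∈ U, ∀ Z', T.mult Z' ≠ 0 → w ∈ Z' → Z' = Z := by
    intro w hw Z' hZ' hwZ'
    by_contra hne
    have h1 : Z' ∈ F' := (hF'mem Z').2 ⟨hFmem Z' hZ' w hwZ' (ball_subset_closedBall hw.1), hne⟩
    exact hw.2 (mem_iUnion₂.2 ⟨Z', h1, hwZ'⟩)
  have hsuppU : T.support ∩ U = Z ∩ U := by
    apply Subset.antisymm
    · rintro w ⟨hw, hwU⟩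
      obtain ⟨Z', hZ', hwZ'⟩ := mem_support_iff.1 hw
      rw [← honly w hwU Z' hZ' hwZ']
      exact ⟨hwZ', hwU⟩
    · exact inter_subset_inter_left _ (subset_support hZ)
  -- `Z ∩ U` is nonempty: `Z ∩ B(a, r₀)` has positive measure, the other components are null in it
  have hZU : (Z ∩ U).Nonempty := by
    by_contra hempty
    rw [not_nonempty_iff_eq_empty] at hempty
    have hsub : ((↑) : Ω → V) '' Z ∩ ball (a : V) r₀ ⊆
        ⋃ Z' ∈ F', (((↑) : Ω → V) '' (Z ∩ Z')) := by
      rintro _ ⟨⟨w, hwZ, rfl⟩, hwb⟩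
      have hwU : w ∉ U := fun h' => (hempty.subset ⟨hwZ, h'⟩ : _)
      have : w ∈ ⋃ Z' ∈ F', Z' := by
        by_contra h'
        exact hwU ⟨hwb, h'⟩
      obtain ⟨Z', hZ', hwZ'⟩ := mem_iUnion₂.1 this
      exact mem_iUnion₂.2 ⟨Z', hZ', w, ⟨hwZ, hwZ'⟩, rfl⟩
    have hnull : μ (⋃ Z' ∈ F', (((↑) : Ω → V) '' (Z ∩ Z'))) = 0 := by
      refine (measure_biUnion_null_iff F'.countable_toSet).2 fun Z' hZ' => ?_
      have h1 := (hF'mem Z').1 hZ'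
      have h2 : Z' ∈ F := h1.1
      rw [hF, Set.Finite.mem_toFinset] at h2
      exact T.euclideanHausdorffMeasure_image_inter_components_eq_zero hZ h2.1 h1.2.symm
    have hpos := hdim.euclideanHausdorffMeasure_image_inter_ball_pos haZ hr₀
    exact (lt_irrefl _) (hpos.trans_le ((measure_mono hsub).trans hnull.le))
  obtain ⟨x, hxZ, hxU⟩ := hZU
  -- a regular point `y` of `Z` in `U`; it is a regular point of `|T|`
  obtain ⟨y, hyU, hyreg⟩ := (hirr.1 x).inter_regularLocus_nonempty hxZ hUo hxU
  set T₂ : HolomorphicChain 𝓘(ℂ, V) Ω (q + 1) := HolomorphicChain.of Z hirr hdim 1 with hT₂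
  have hT₂supp : T₂.support = Z := support_of hirr hdim one_ne_zero
  have hcar : T.carrier ∩ ((↑) : Ω → V) '' U = T₂.carrier ∩ ((↑) : Ω → V) '' U :=
    T.carrier_inter_image_eq T₂ hUo (by rw [hsuppU, hT₂supp])
  have hycar : (y : V) ∈ T.carrier := by
    have : (y : V) ∈ T₂.carrier ∩ ((↑) : Ω → V) '' U :=
      ⟨⟨y, by rw [hT₂supp]; exact hyreg, rfl⟩, y, hyU, rfl⟩
    rw [← hcar] at this
    exact this.1
  have hyregT : y ∈ regularLocus 𝓘(ℂ, V) T.support := by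
    obtain ⟨y', hy', hyy'⟩ := hycar
    obtain rfl : y' = y := Subtype.ext hyy'
    exact hy'
  -- a good neighbourhood `N ⊆ U` of `y`: `|T| ∩ N ⊆ reg|T|`, and the density is `k_Z` there
  obtain ⟨N, hNo, hyN, hNU, -, hNreg⟩ :=
    exists_nhds_preconnected_of_mem_regularLocus hyregT (hUo.mem_nhds hyU)
  have hNoV : IsOpen (((↑) : Ω → V) '' N) := Ω.2.isOpenMap_subtype_val N hNo
  have hdens : ∀ w ∈ T.support ∩ N, T.multAt w = T.mult Z := fun w hw => by
    have hwZ : w ∈ Z := (hsuppU.subset ⟨hw.1, hNU hw.2⟩).1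
    exact multAt_eq_mult hwZ fun Z' hZ' hwZ' => honly w (hNU hw.2) Z' hZ' hwZ'
  -- a bump `χ` at `y` supported in `N`
  obtain ⟨ε, hε, hεN⟩ := Metric.isOpen_iff.1 hNoV (y : V) ⟨y, hyN, rfl⟩
  let β : ContDiffBump (y : V) := ⟨ε / 4, ε / 2, by positivity, by linarith⟩
  have hβN : tsupport (β : V → ℝ) ⊆ ((↑) : Ω → V) '' N := by
    rw [β.tsupport_eq]
    exact (closedBall_subset_ball (by show ε / 2 < ε; linarith)).trans hεN
  have hNΩ : ((↑) : Ω → V) '' N ⊆ (Ω : Set V) := by rintro _ ⟨w, -, rfl⟩; exact w.2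
  let χ : 𝓓(Ω, ℝ) := ⟨β, β.contDiff, β.hasCompactSupport, hβN.trans hNΩ⟩
  have hχx : ∀ x, χ x = β x := fun x => rfl
  -- `[T](χ K_p) = k_Z ∫_{reg|T|} χ`
  have hval : T.toCurrent (smulCovectorCLM (kaehlerPow (q + 1)) χ) =
      (T.mult Z : ℝ) * ∫ x in T.carrier, β x ∂μ := by
    rw [T.toCurrent_smul_kaehlerPow_apply χ, ← integral_const_mul]
    refine setIntegral_congr_fun T.measurableSet_carrier fun x hx => ?_
    rw [hχx]
    by_cases hxN : x ∈ ((↑) : Ω → V) '' N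
    · obtain ⟨w, hwN, rfl⟩ := hxN
      obtain ⟨w', hw', hww'⟩ := hx
      obtain rfl : w' = w := Subtype.ext hww'
      rw [density_apply_coe, hdens w' ⟨hw'.1, hwN⟩]
    · rw [image_eq_zero_of_notMem_tsupport fun h' => hxN (hβN h'), mul_zero, mul_zero]
  -- `∫_{reg|T|} χ > 0`
  have hne : T.support.Nonempty := ⟨a, subset_support hZ haZ⟩
  have hfin : μ (T.carrier ∩ closedBall (y : V) (ε / 2)) < ⊤ :=
    T.measure_carrier_inter_lt_top (isCompact_closedBall _ _)
      ((closedBall_subset_ball (by linarith)).trans (hεN.trans hNΩ))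
  have hint : IntegrableOn (fun x => β x) T.carrier μ := by
    have h1 : IntegrableOn (fun x => β x) (T.carrier ∩ closedBall (y : V) (ε / 2)) μ :=
      Measure.integrableOn_of_bounded (M := 1) hfin.ne β.continuous.aestronglyMeasurable
        (Eventually.of_forall fun x => by
          rw [Real.norm_of_nonneg (β.nonneg' x)]; exact β.le_one)
    refine h1.of_ae_sdiff_eq_zero T.measurableSet_carrier.nullMeasurableSet
      (Eventually.of_forall fun x hx => ?_)
    refine image_eq_zero_of_notMem_tsupport fun h' => hx.2 ⟨hx.1, ?_⟩
    rw [β.tsupport_eq] at h'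
    exact h'
  have hposint : 0 < ∫ x in T.carrier, β x ∂μ := by
    have hmeas : 0 < μ (T.carrier ∩ ball (y : V) (ε / 4)) := by
      have hnull := T.euclideanHausdorffMeasure_two_mul_image_singularLocus_eq_zero
      have hpos := (T.hasPureDim_support hne).euclideanHausdorffMeasure_image_inter_ball_pos
        (regularLocus_subset _ hyregT) (show (0 : ℝ) < ε / 4 by positivity)
      have hsplit : ((↑) : Ω → V) '' T.support ∩ ball (y : V) (ε / 4) ⊆
          T.carrier ∩ ball (y : V) (ε / 4) ∪ ((↑) : Ω → V) '' singularLocus 𝓘(ℂ, V) T.support := by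
        rintro _ ⟨⟨w, hw, rfl⟩, hwb⟩
        by_cases hwr : w ∈ regularLocus 𝓘(ℂ, V) T.support
        · exact Or.inl ⟨⟨w, hwr, rfl⟩, hwb⟩
        · exact Or.inr ⟨w, ⟨hw, hwr⟩, rfl⟩
      refine pos_iff_ne_zero.2 fun h0 => (lt_irrefl (0 : ℝ≥0∞)) (hpos.trans_le ?_)
      calc μ (((↑) : Ω → V) '' T.support ∩ ball (y : V) (ε / 4))
          ≤ μ (T.carrier ∩ ball (y : V) (ε / 4)) +
              μ (((↑) : Ω → V) '' singularLocus 𝓘(ℂ, V) T.support) :=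
            (measure_mono hsplit).trans (measure_union_le _ _)
        _ = 0 := by rw [h0, hnull, add_zero]
    have hfin' : μ (T.carrier ∩ ball (y : V) (ε / 4)) < ⊤ :=
      (measure_mono (inter_subset_inter_right _ (ball_subset_closedBall.trans
        (closedBall_subset_closedBall (by linarith))))).trans_lt hfin
    calc (0 : ℝ) < (μ (T.carrier ∩ ball (y : V) (ε / 4))).toReal :=
          ENNReal.toReal_pos hmeas.ne' hfin'.ne
      _ = ∫ x in T.carrier ∩ ball (y : V) (ε / 4), (1 : ℝ) ∂μ := by
          rw [setIntegral_const, smul_eq_mul, mul_one, measureReal_def]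
      _ = ∫ x in T.carrier ∩ ball (y : V) (ε / 4), β x ∂μ := by
          refine setIntegral_congr_fun (T.measurableSet_carrier.inter measurableSet_ball)
            fun x hx => (β.one_of_mem_closedBall (ball_subset_closedBall hx.2)).symm
      _ ≤ ∫ x in T.carrier, β x ∂μ :=
          setIntegral_mono_set hint (Eventually.of_forall fun x => β.nonneg' x)
            (Eventually.of_forall inter_subset_left)
  -- conclude
  have h0 := hS χ fun x => β.nonneg' x
  rw [hval] at h0
  exact_mod_cast (mul_nonneg_iff_of_pos_right hposint).1 h0

/-! ### Limits of positive chains -/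

/-- **Weak limits of positive holomorphic chains are positive**: if the `T_j` are positive
`p`-chains (`p = q + 1`) and `[T_j] → [T]` in the sense of currents, then `T` is positive.
[cite: Chirka1989, §16.1 Prop. 1, p. 207] -/
theorem mult_nonneg_of_tendsto (T : ℕ → HolomorphicChain 𝓘(ℂ, V) Ω (q + 1))
    (hpos : ∀ j Z, 0 ≤ (T j).mult Z) {T' : HolomorphicChain 𝓘(ℂ, V) Ω (q + 1)}
    (hconv : ∀ ψ, Tendsto (fun j => (T j).toCurrent ψ) atTop (𝓝 (T'.toCurrent ψ))) (Z : Set Ω) :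
    0 ≤ T'.mult Z :=
  T'.mult_nonneg_of_toCurrent_smul_kaehlerPow_nonneg (fun χ hχ =>
    ge_of_tendsto' (hconv _) fun j => (T j).toCurrent_smul_kaehlerPow_nonneg (hpos j) χ hχ) Z

/-- **Compactness of positive holomorphic chains** [Chirka1989, §16.1 Prop. 1 (2), positive case]:
a sequence of POSITIVE holomorphic `p`-chains with locally uniformly bounded masses has a
subsequence converging in the sense of currents to a POSITIVE holomorphic `p`-chain.
[cite: Chirka1989, §16.1 Prop. 1 (2), pp. 206–207] -/
theorem exists_subseq_tendsto_toCurrent_of_mult_nonneg (T : ℕ → HolomorphicChain 𝓘(ℂ, V) Ω (q + 1))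
    (hpos : ∀ j Z, 0 ≤ (T j).mult Z)
    (hmass : ∀ K : Set V, IsCompact K → K ⊆ (Ω : Set V) → ∃ M : ℝ≥0∞, M < ⊤ ∧
      ∀ j, (T j).toCurrent.variation K ≤ M) :
    ∃ (T' : HolomorphicChain 𝓘(ℂ, V) Ω (q + 1)) (ι : ℕ → ℕ), StrictMono ι ∧
      (∀ ψ, Tendsto (fun j => (T (ι j)).toCurrent ψ) atTop (𝓝 (T'.toCurrent ψ))) ∧
      ∀ Z, 0 ≤ T'.mult Z := by
  obtain ⟨T', ι, hι, hconv⟩ := HolomorphicChain.exists_subseq_tendsto_toCurrent T hmass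
  exact ⟨T', ι, hι, hconv, mult_nonneg_of_tendsto (fun j => T (ι j)) (fun j => hpos (ι j)) hconv⟩

end HolomorphicChain

end Literature.Geometry.Kaehler

end
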